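/-
Chen 2024 (IACR ePrint 2024/555, version of 2024-04-18), §3.5.3–§3.5.7 = Steps 3–7: eq. (22)–(23) p. 24–25 with
Lemma 3.21 p. 44 (Step 3: completing the square, `Σ⁻¹ = t²Iₙ + xxᵀ` and eq. (23)(b), its Sherman–Morrison
inverse "derived from Formula (8)" = Lemma 2.3 p. 9); §3.5.5 p. 26–27 (Step 5: modulus splitting `P = M(t²+u²)`,
C.2); eq. (27)–(30) p. 27–28 (Step 6: the displayed `|φ‴₆⟩`, its phase `φ₆`, eq. (28), the centres (29), the
regrouping (30), and the remark p. 28–29 that `f₆` is `M`-periodic); Lemma 3.11, eq. (31)–(35) and Claim 3.12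
p. 29–31 (Step 7: extracting the centres); eq. (51) p. 46; Conditions C.1–C.3, C.6 p. 18–19; eq. (12) p. 17.
THE EXACT SKELETON OF STEPS 3–7: every "=" of these steps typed over ARBITRARY REAL DATA (vectors `ι → ℝ` over a
finite index type) and kernel-checked as a polynomial / rational identity, with the places where the CORRECT
GUESS `u² = ‖x‖²` (C.2: `M = 2(t²+u²)`), `x = D·b` with `b₁ = −1`, `b_{2..n} ∈ 2ℤ` (eq. (12)), `y′ = v + y`
(Step 1) and C.1 (`t²/D² ∈ ℤ`) are load-bearing made explicit as hypotheses — together with GENERAL forms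
(`u2_shift_tail_general`, `u2_shift_head_general`, `u3_shift_head_general`, `u2_cOf_general`) showing that the
invariances FAIL when `M ≠ 2(t²+‖x‖²)`, i.e. when the guess of `‖x‖²` is wrong.

REPRODUCTION / ANALYSIS OF A CLAIMED RESULT UNDER ADJUDICATION (withdrawn by its author, note of 2024-04-18).
HONEST FRAMING: the VALUE is a THEOREM / DECIDABLE VERDICT / CERTIFICATE / precise negative result — NOT
summit progress.  What is certified here is that the ALGEBRA of Steps 3–7 is right as printed (up to one
typographical slip in eq. (33), line 2, where the vector `x` after `⟨x,z′⟩/(t²+‖x‖²)` is dropped), that the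
DISPLAYED Step-6 sum (27) is EXACTLY `M`-periodic in `c` under the paper's conditions (the Step-6 analogue of
the periodicity premise that FAILS in Step 9, `ChenQuantumLWESteps` / `ChenQuantumLWEDisplayRefutation`), and
that Claim 3.12 holds as an exact identity whose chirp docks onto `Shape.phi7` of `ChenQuantumLWESteps`.  The
`≈_t` approximations of these steps (Lemmas 3.20, 3.22–3.24, 3.27–3.29: Gaussian tails, replacing narrow
Gaussians by windows) and the `n`-dimensional Poisson summation behind eq. (24) are NOT typed.  Nothing is
repaired, nothing is broken, no cryptanalytic claim.  No named fact is introduced (debt 0).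
-/
import Literature.Computability.Cryptography.ChenQuantumLWESteps
import Mathlib.Data.Matrix.Mul
import Mathlib.Algebra.Order.Round
import Mathlib.Algebra.BigOperators.Field
import Mathlib.Analysis.SpecialFunctions.Trigonometric.Basic

/-!
# Chen 2024, Steps 3–7: the exact identities (eq. (22)–(23), Step 5, eq. (27)–(35), Claim 3.12)

After Steps 1–2 the registers hold `|φ₂⟩` (eq. (18)); Step 3 applies the complex-Gaussian window of eq. (19)
with `(s′)⁴ = (t² + ‖x‖²)²t²` (C.2, the correct guess `u² = ‖x‖²`), completes the square (eq. (22)–(23),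
Lemma 3.21) and measures `z′`; Step 4 is `QFT_{ℤ_Pⁿ}` (eq. (24), Poisson summation); Step 5 splits `P = M(t²+u²)`
and measures `h* = h″` (eq. (25)–(26)); Step 6 is `QFT_{ℤ_Mⁿ}` followed by three `≈_t` manipulations, ending in the
displayed state (27) `|φ‴₆⟩ = Σ_{c} Σ_{k∈0|ℤⁿ⁻¹, j∈ℤ, ‖c − centre(k,j)‖_∞ ≤ σ log n} e^{−π‖u₁‖²/σ²} e^{−(π/σ_x²)‖u₂x‖²}
e^{2πiφ₆(c,k,j)} |c mod M⟩` with `φ₆` as in eq. (28); Step 7 (Lemma 3.11) adds `z′ + h* − y′`, rounds to `Dℤⁿ`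
(eq. (31)), subtracts (eq. (32)) and computes the new phase (eq. (33), Claim 3.12), arriving at eq. (34)–(35)
`|φ₇⟩ = Σ_{k∈0|ℤⁿ⁻¹, j∈ℤ} e^{−2πi(2Dj)²/(2M)} e^{2πi‖k‖²/4} |(2Dj)x + v′ + (M/2)k mod M⟩` — the input of Step 8
(`Shape.phi7`).

Everything below is stated for arbitrary real data: `tsq = t²`, `M`, `D ∈ ℝ`, vectors `x, y, z′, hs = h*,
y′, v : ι → ℝ`, `kr = k′ ∈ ℝ` (bundled as `Steps3to7.Data`), `nx := ‖x‖² = ⟨x,x⟩`, `S := t² + ‖x‖²`.  The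
paper's objects are integer vectors; integrality enters only through explicit hypotheses (`x = D·b`, `k ∈ ℤⁿ`,
`j ∈ ℤ`, `t² = D²τ`), so each theorem shows exactly which condition each printed "=" uses.

## What is proved

* **Step 3.** `lemma321`: `(Pj + ⟨x,z⟩)² + t²‖z − z′‖² = (z − d_j)ᵀΣ⁻¹(z − d_j) + C_j` with `Σ⁻¹ = t²Iₙ + xxᵀ`,
  `d_j = z′ − x(Pj + ⟨x,z′⟩)/(t²+‖x‖²)`, `C_j = t²(Pj + ⟨x,z′⟩)²/(t²+‖x‖²)` (Lemma 3.21 = eq. (22)(a)/(23));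
  `sigmaInvQF_eq_dotProduct_mulVec` (the quadratic form is `wᵀΣ⁻¹w`); `eq23b`: `Σ⁻¹Σ = ΣΣ⁻¹ = Iₙ` for
  `Σ = t⁻²(Iₙ − xxᵀ/(t²+‖x‖²))` (eq. (23)(b)), for `t² ≠ 0`, `t²+‖x‖² ≠ 0`.
* **Step 5.** `step5_center_perp` (`⟨x, (⟨x,y⟩/‖x‖²)x − y⟩ = 0`: why the `j`-phase of (25) does not see `y`);
  `step5_rescale` (`(h′(t²+u²) + h* + m)/P = (h′ + (h*+m)/(t²+u²))/M` when `P = M(t²+u²)`); `step5_integral` +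
  `cexp_two_pi_mul_I_eq_of_sub_int` (the exponent `⟨xj, h′ + (h*+m)/(t²+‖x‖²)⟩` differs from `⟨xj, h*/(t²+‖x‖²)⟩`
  by an integer when `h′, x ∈ ℤⁿ`, `j ∈ ℤ`, `m ∈ Pℤⁿ = M(t²+‖x‖²)ℤⁿ`, so the two phases of p. 27 are equal);
  `eq51_rescale` (the "`=^{C.5,C.2}`" of eq. (51) p. 46: `2(t²+‖x‖²)a/P = a/(t²+‖x‖²)` for `P = 2(t²+‖x‖²)²`).
* **Step 6.** `Data.phi6` is eq. (28) verbatim; `eq30_regroup` is eq. (30) (`kᵀa/M − ‖a‖²/M² = −‖a − (M/2)k‖²/M²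
  + ‖k‖²/4`).  **`M`-periodicity of the displayed sum, term by term and summed** (remark p. 28–29): for the shift
  `c ↦ c + M·eᵢ` of a TAIL coordinate re-index `(k,j) ↦ (k + 2eᵢ, j + xᵢ/D)`; for the HEAD coordinate `i₀`
  (`k_{i₀} = 0`, `x_{i₀} = −D`) re-index `(k,j) ↦ (k + (2/D)x + 2e_{i₀}, j − 1 − t²/D²)`.  Then the three envelope
  arguments `u₁ = Π_⊥(c′ − (M/2)k)`, `u₂ = 2Dj − B`, `u₃ = centre − c` are INVARIANT (`u1_shift_*`, `u2_shift_*`,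
  `u3_shift_*`; `u₂, u₃` need `M = 2(t²+‖x‖²)`) and `φ₆` moves by EXACTLY `kᵢ + 1` (`phi6_shift_tail`), resp.
  `k_{i₀} + 2j − 1 − t²/D²` (`phi6_shift_head`) — integers iff `k ∈ ℤⁿ`, `j ∈ ℤ`, `t²/D² ∈ ℤ` (C.1:
  `t² = c·D²‖b‖²`); hence `term_shift_tail/head` (every (27)-shaped summand, ANY envelope `g(u₁,u₂,u₃)`, is
  invariant) and **`f6_periodic_tail`, `f6_periodic_head`**: `f₆(c + M eᵢ) = f₆(c)` for the displayed sum over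
  `k ∈ 0|ℤⁿ⁻¹`, `j ∈ ℤ`, given `x = D·b` (`b ∈ ℤⁿ`, `b_{i₀} = −1`), `t² = D²τ` (`τ ∈ ℤ`), `M = 2(t²+‖x‖²)`,
  `D, ‖x‖², t²+‖x‖² ≠ 0` (via an explicit re-indexing `Equiv`, `shiftEquiv`; no summability needed).
  GENERAL forms: `u2_shift_tail_general` (`u₂` moves by `(2 − M/(t²+‖x‖²))xᵢ`), `u2_shift_head_general`
  (by `(M/(t²+‖x‖²) − 2)(t² + D²)/D`), `u3_shift_head_general` (by `((M − 2(t²+‖x‖²))/D)·x`): with a WRONG guess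
  of `‖x‖²` the displayed envelope is not invariant under these re-indexings.
* **Step 7.** `eq31_decomp` / `eq31_round` / `R_mem_DZ` (eq. (31): `c + z′ + h* − y′ = R(k,j) + ((θ″−k′)x + u)`
  for `c = centre(k,j) + u`; rounding to `Dℤⁿ` returns `R(k,j) = (M/2)k + (2Dj − ⟨k,x⟩ + k′)x − v` (eq. (32))
  coordinatewise whenever `R ∈ Dℤⁿ` and the perturbation is `< D/2` in `ℓ_∞` — `eq31b_round`; `R ∈ Dℤⁿ` for
  `x = Db`, `v ∈ Dℤⁿ`, `M = 2D²P′`, `k ∈ ℤⁿ`, `j, k′, D ∈ ℤ`); `eq33_line1`–`eq33_line4`, `eq33_perp`, `W_cOf`,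
  `u2_cOf` (eq. (33): after substituting `c = d − z′ − h* + y′ + R(k,j)`, `Π_⊥(c′ − (M/2)k) = Π_⊥ d` and
  `u₂ = L(d)` are `(k,j)`-free; line 2 as printed drops an `x` — `eq33_line2` is the corrected line; line 4
  NEEDS `M = 2(t²+‖x‖²)`: `u2_cOf_general` shows `u₂ = L(d) + (1 − M/(2(t²+‖x‖²)))⟨k,x⟩` in general);
  **`claim312_exact`**: `φ₆(c(d,k,j),k,j) = Φ₀(d) − (2Dj − ⟨k,x⟩)²/(2M) + ‖k‖²/4` with an explicit `(k,j)`-free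
  `Φ₀(d)` (Claim 3.12 with its "∝" made explicit; hypotheses `y′ = v + y`, `M = 2(t²+‖x‖²)`, `‖x‖² ≠ 0`,
  `t²+‖x‖² ≠ 0`, no integrality), `claim312_cexp` (the printed product of three phase factors), `R_eq_eq35`
  (`R = (2Dj′)x + v′ + (M/2)k` with `2Dj′ = 2Dj − ⟨k,x⟩`, `v′ = k′x − v`, eq. (34)–(35)).
* **Dictionary to `Shape.phi7`.** `twoDj_sub_dot_mem` (`⟨k,x⟩ ∈ 2Dℤ` for `k ∈ 0|ℤⁿ⁻¹`, `x = Db`, `b_tail ∈ 2ℤ`,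
  so `j′ ∈ ℤ`, p. 31); `chirp_exponent` and `e_chirp_eq_phi7_phase` (`(2Dj)²/(2M) = j²/P′` for `M = 2D²P′`, C.3 —
  for every `Shape`, `e(−(2Dj)²/(2·Shape.M)) = e(−j²/Shape.P)`, the chirp of `Shape.phi7`);
  `conditions_bookkeeping` (C.1–C.3: `t² = c‖x‖²`, `‖x‖² = D²‖b‖²`, `(c+1)‖b‖² = P′` give `2(t²+‖x‖²) = 2D²P′`
  and `t²/D² = c‖b‖² `).

## What is NOT here

No `≈_t` statement: Lemma 3.20 (Step 3 tails), eq. (24) (the `n`-dimensional Poisson summation `QFT_{ℤ_Pⁿ}` of a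
discrete Gaussian with covariance `Σ`; Mathlib has the one-dimensional formula only), Lemmas 3.22–3.24 (Step 5/6
supports), Lemmas 3.27–3.29 (Step 6: replacing the narrow Gaussians by the window of (27)) are not typed; no
amplitude bookkeeping across the QFTs (the states `|φ₃⟩, …, |φ₆⟩` themselves are not constructed — only the
displayed amplitude FUNCTIONS and their exact transformation rules); no probability of measurement outcomes;
C.6 (`σ log n < D/4`) enters only as the hypothesis `|ε| < D/2` of `eq31_round`.
-/

namespace Literature.Computability.Cryptography.Chen2024

open scoped BigOperators
open Matrix

namespace Steps3to7

variable {ι : Type*} [Fintype ι]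

noncomputable section

/-! ## 0. Two elementary identities -/

/-- `exp(2πi·a) = exp(2πi·b)` whenever `a − b ∈ ℤ`. [folklore] -/
theorem cexp_two_pi_mul_I_eq_of_sub_int {a b : ℝ} (N : ℤ) (h : a = b + N) :
    Complex.exp (2 * Real.pi * Complex.I * a) = Complex.exp (2 * Real.pi * Complex.I * b) := by
  rw [h]
  push_cast
  rw [mul_add, Complex.exp_add]
  have : Complex.exp (2 * Real.pi * Complex.I * (N : ℂ)) = 1 := by
    rw [show 2 * (Real.pi : ℂ) * Complex.I * (N : ℂ) = N * (2 * Real.pi * Complex.I) by ring]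
    exact Complex.exp_int_mul_two_pi_mul_I N
  rw [this, mul_one]

/-- `‖u + λx‖² = ‖u‖² + 2λ⟨x,u⟩ + λ²‖x‖²`. [folklore] -/
private theorem dot_add_smul_self (u x : ι → ℝ) (l : ℝ) :
    (u + l • x) ⬝ᵥ (u + l • x) = u ⬝ᵥ u + 2 * l * (x ⬝ᵥ u) + l ^ 2 * (x ⬝ᵥ x) := by
  simp only [add_dotProduct, dotProduct_add, smul_dotProduct, dotProduct_smul, smul_eq_mul,
    dotProduct_comm u x]
  ring

/-- `‖u + λx‖² = ‖u‖² + 2λ⟨u,x⟩ + λ²‖x‖²`. [folklore] -/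
private theorem dot_add_smul_self' (u x : ι → ℝ) (l : ℝ) :
    (u + l • x) ⬝ᵥ (u + l • x) = u ⬝ᵥ u + 2 * l * (u ⬝ᵥ x) + l ^ 2 * (x ⬝ᵥ x) := by
  simp only [add_dotProduct, dotProduct_add, smul_dotProduct, dotProduct_smul, smul_eq_mul,
    dotProduct_comm x u]
  ring

/-! ## 1. Step 3 (§3.5.3 p. 24–25; Lemma 3.21 p. 44): completing the square, eq. (22)(a)–(23) -/

/-- The quadratic form `wᵀ Σ⁻¹ w = t²‖w‖² + ⟨x,w⟩²` of `Σ⁻¹ := t² Iₙ + x xᵀ`.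
[cite: ChenQuantumLattice2024, eq. (23) p. 25] -/
def sigmaInvQF (tsq : ℝ) (x w : ι → ℝ) : ℝ := tsq * (w ⬝ᵥ w) + (x ⬝ᵥ w) ^ 2

/-- `Σ⁻¹ := t² Iₙ + x xᵀ ∈ ℤⁿˣⁿ`. [cite: ChenQuantumLattice2024, eq. (23) p. 25] -/
def sigmaInv [DecidableEq ι] (tsq : ℝ) (x : ι → ℝ) : Matrix ι ι ℝ :=
  tsq • (1 : Matrix ι ι ℝ) + vecMulVec x x

/-- `Σ = (1/t²)·(Iₙ − x xᵀ/(t² + ‖x‖²))` ("derived from Formula (8)" = Lemma 2.3 p. 9).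
[cite: ChenQuantumLattice2024, eq. (23)(b) p. 25] -/
def sigma [DecidableEq ι] (tsq : ℝ) (x : ι → ℝ) : Matrix ι ι ℝ :=
  (1 / tsq) • ((1 : Matrix ι ι ℝ) - (1 / (tsq + x ⬝ᵥ x)) • vecMulVec x x)

/-- `t²‖w‖² + ⟨x,w⟩² = wᵀ(t²Iₙ + xxᵀ)w`. [cite: ChenQuantumLattice2024, eq. (23) p. 25] -/
theorem sigmaInvQF_eq_dotProduct_mulVec [DecidableEq ι] (tsq : ℝ) (x w : ι → ℝ) :
    sigmaInvQF tsq x w = w ⬝ᵥ (sigmaInv tsq x *ᵥ w) := by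
  simp only [sigmaInvQF, sigmaInv, add_mulVec, smul_mulVec, one_mulVec, vecMulVec_mulVec,
    op_smul_eq_smul, dotProduct_add, dotProduct_smul, smul_eq_mul, dotProduct_comm w x]
  ring

/-- `d_j := z′ − x·(Pj + ⟨x,z′⟩)/(t² + ‖x‖²)`. [cite: ChenQuantumLattice2024, eq. (23) p. 25] -/
def dVec (tsq P : ℝ) (x z' : ι → ℝ) (j : ℝ) : ι → ℝ :=
  z' - ((P * j + x ⬝ᵥ z') / (tsq + x ⬝ᵥ x)) • x

/-- `C_j := t²/(t² + ‖x‖²)·(Pj + ⟨x,z′⟩)²`. [cite: ChenQuantumLattice2024, eq. (23) p. 25] -/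
def cConst (tsq P : ℝ) (x z' : ι → ℝ) (j : ℝ) : ℝ :=
  tsq / (tsq + x ⬝ᵥ x) * (P * j + x ⬝ᵥ z') ^ 2

/-- **Lemma 3.21**, the identity behind eq. (22)(a): for every `z`,
`(Pj + ⟨x,z⟩)² + t²‖z − z′‖² = (z − d_j)ᵀ Σ⁻¹ (z − d_j) + C_j`.  Exact, for all real data with `t² + ‖x‖² ≠ 0`.
[cite: ChenQuantumLattice2024, Lemma 3.21 p. 44; eq. (22)–(23) p. 25] -/
theorem lemma321 (tsq P : ℝ) (x z z' : ι → ℝ) (j : ℝ) (hS : tsq + x ⬝ᵥ x ≠ 0) :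
    (P * j + x ⬝ᵥ z) ^ 2 + tsq * ((z - z') ⬝ᵥ (z - z')) =
      sigmaInvQF tsq x (z - dVec tsq P x z' j) + cConst tsq P x z' j := by
  have hz : z - dVec tsq P x z' j = (z - z') + ((P * j + x ⬝ᵥ z') / (tsq + x ⬝ᵥ x)) • x := by
    simp only [dVec]; abel
  rw [sigmaInvQF, hz, dot_add_smul_self, dotProduct_add, dotProduct_smul, smul_eq_mul, dotProduct_sub x z z',
    cConst]
  field_simp
  ring

/-- Eq. (23)(b) (Sherman–Morrison, Formula (8) of Lemma 2.3 p. 9): `Σ⁻¹·Σ = Iₙ` and `Σ·Σ⁻¹ = Iₙ` for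
`Σ⁻¹ = t²Iₙ + xxᵀ`, `Σ = (1/t²)(Iₙ − xxᵀ/(t²+‖x‖²))`, whenever `t² ≠ 0` and `t² + ‖x‖² ≠ 0`.
[cite: ChenQuantumLattice2024, eq. (23)(b) p. 25; Lemma 2.3 eq. (8) p. 9] -/
theorem eq23b [DecidableEq ι] (tsq : ℝ) (x : ι → ℝ) (ht : tsq ≠ 0) (hS : tsq + x ⬝ᵥ x ≠ 0) :
    sigmaInv tsq x * sigma tsq x = 1 ∧ sigma tsq x * sigmaInv tsq x = 1 := by
  have hV : vecMulVec x x * vecMulVec x x = (x ⬝ᵥ x) • vecMulVec x x := by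
    rw [vecMulVec_mul_vecMulVec, vecMulVec_smul]
  have key : ∀ i j : ι, (sigmaInv tsq x * sigma tsq x) i j = (1 : Matrix ι ι ℝ) i j ∧
      (sigma tsq x * sigmaInv tsq x) i j = (1 : Matrix ι ι ℝ) i j := by
    intro i j
    simp only [sigmaInv, sigma, add_mul, mul_add, mul_sub, sub_mul, smul_mul_assoc, mul_smul_comm,
      Matrix.one_mul, Matrix.mul_one, hV, smul_sub, smul_smul, Matrix.add_apply, Matrix.sub_apply,
      Matrix.smul_apply, vecMulVec_apply, Matrix.one_apply, smul_eq_mul]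
    constructor <;> (split_ifs <;> field_simp <;> ring)
  exact ⟨Matrix.ext fun i j => (key i j).1, Matrix.ext fun i j => (key i j).2⟩

/-! ## 2. Step 5 (§3.5.5 p. 26–27): modulus splitting — the exact bookkeeping -/

/-- The `y`-part of the Gaussian centre of (25) is orthogonal to `x`: `⟨x, (⟨x,y⟩/‖x‖²)x − y⟩ = 0` (`‖x‖² ≠ 0`),
which is why the `j`-dependent phase of eq. (25)/(26) does not see `⟨x,y⟩x/‖x‖² − y` (p. 27: "the only term that
depends on all `h′, m, j`"). [cite: ChenQuantumLattice2024, eq. (25)–(26) p. 26–27] -/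
theorem step5_center_perp (x y : ι → ℝ) (hx : x ⬝ᵥ x ≠ 0) :
    x ⬝ᵥ (((x ⬝ᵥ y) / (x ⬝ᵥ x)) • x - y) = 0 := by
  rw [dotProduct_sub, dotProduct_smul, smul_eq_mul, div_mul_cancel₀ _ hx, sub_self]

omit [Fintype ι] in
/-- Rescaling of the register (p. 27, first display): with `P = M·(t²+u²)` (Cond. C.2) and `h = h′(t²+u²) + h″`,
`(h′(t²+u²) + h* + m)/P = (h′ + (h* + m)/(t²+u²))/M`, coordinatewise.
[cite: ChenQuantumLattice2024, §3.5.5 p. 27; Cond. C.2 p. 18] -/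
theorem step5_rescale (S M P : ℝ) (hS : S ≠ 0) (hM : M ≠ 0) (hP : P = M * S) (h' hs m : ι → ℝ) :
    (1 / P) • (S • h' + hs + m) = (1 / M) • (h' + (1 / S) • (hs + m)) := by
  ext i
  simp only [Pi.smul_apply, Pi.add_apply, smul_eq_mul, hP]
  field_simp
  ring

/-- The integrality step of p. 27: "Since `h′ + m/(t²+‖x‖²) ∈ ℤⁿ`, `x ∈ ℤⁿ`, `j ∈ ℤ`, so
`e^{2πi⟨xj, h′ + (h*+m)/(t²+‖x‖²)⟩} = e^{2πi⟨xj, h*/(t²+‖x‖²)⟩}`": the two exponents differ by an INTEGER.  Here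
`m ∈ Pℤⁿ` with `P = M(t²+‖x‖²)` and `M ∈ ℤ`, so `m/(t²+‖x‖²) = M·m′` is integral.
[cite: ChenQuantumLattice2024, §3.5.5 p. 27] -/
theorem step5_integral (S M : ℝ) (hS : S ≠ 0) (Mz : ℤ) (hM : M = Mz) (x h' m' : ι → ℤ) (hs : ι → ℝ)
    (j : ℤ) :
    ∃ N : ℤ, (j : ℝ) * ((fun i => (x i : ℝ)) ⬝ᵥ ((fun i => (h' i : ℝ)) + (1 / S) • (hs + (M * S) • (fun i => (m' i : ℝ)))))
      = (j : ℝ) * ((fun i => (x i : ℝ)) ⬝ᵥ hs) / S + N := by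
  refine ⟨j * (x ⬝ᵥ (h' + Mz • m')), ?_⟩
  have key : ∀ i, (j : ℝ) * ((x i : ℝ) * ((h' i : ℝ) + 1 / S * (hs i + M * S * (m' i : ℝ)))) =
      (j : ℝ) * ((x i : ℝ) * hs i) / S + (j : ℝ) * ((x i : ℝ) * ((h' i : ℝ) + (Mz : ℝ) * (m' i : ℝ))) := by
    intro i; rw [hM]; field_simp; ring
  simp only [dotProduct, Pi.add_apply, Pi.smul_apply, smul_eq_mul, Finset.mul_sum, key,
    Finset.sum_add_distrib, Int.cast_mul, Int.cast_sum, Int.cast_add, zsmul_eq_mul, Pi.mul_apply,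
    Finset.sum_div]
  congr 1

/-- Eq. (51) p. 46, the step "`=^{C.5,C.2}`": with `P = 2(t²+‖x‖²)²` (C.2: `P = M(t²+u²)`, `M = 2(t²+u²)`,
`u² = ‖x‖²`), `2(t²+‖x‖²)·a/P = a/(t²+‖x‖²)`. [cite: ChenQuantumLattice2024, eq. (51) p. 46; Cond. C.2 p. 18] -/
theorem eq51_rescale (S P a : ℝ) (hS : S ≠ 0) (hP : P = 2 * S ^ 2) : 2 * S * a / P = a / S := by
  rw [hP]; field_simp

/-! ## 3. Eq. (31)(b) (p. 29): rounding to `Dℤ` recovers a `Dℤ`-point -/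

/-- Eq. (31)(b), scalar form: if `p ∈ Dℤ` and the perturbation is `< D/2` in absolute value, rounding to the
nearest multiple of `D` returns `p`: `D·round((p + ε)/D) = p`.  (The paper uses it coordinatewise with
`|ε| ≤ σ log n + D/4 < D/2` by C.6.) [cite: ChenQuantumLattice2024, eq. (31) p. 29; Cond. C.6 p. 19] -/
theorem eq31b_round (D : ℝ) (hD : 0 < D) (p ε : ℝ) (hp : ∃ a : ℤ, p = D * a) (hε : |ε| < D / 2) :
    D * (round ((p + ε) / D) : ℝ) = p := by
  obtain ⟨a, rfl⟩ := hp
  have h1 : (D * a + ε) / D = ε / D + a := by field_simp; ring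
  rw [h1, round_add_intCast]
  have h2 : round (ε / D) = 0 := by
    rw [round_eq_zero_iff]
    rw [abs_lt] at hε
    constructor
    · rw [le_div_iff₀ hD]; linarith [hε.1]
    · rw [div_lt_iff₀ hD]; linarith [hε.2]
  simp [h2]

/-! ## 4. Steps 6–7: the data and the displayed objects of eq. (27)–(29) -/

/-- The real data entering Steps 6–7 (all vectors read in `ℝⁿ`; the paper's are integer vectors):
`tsq = t²`; `M` the small modulus (C.2: `M = 2(t² + u²)` with the GUESS `u²` of `‖x‖²`); `D` the scaling
factor of `x = D·b` (eq. (12)); `x` the shortest vector; `y` (Step 1, unknown), `z′` (Step 3 outcome), `hs = h*`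
(Step 5 outcome), `y′ = v + y` (Step 1 outcome, `v ∈ L`), `kr = k′ := round(⟨z′+h*,x⟩/(t²+‖x‖²) − ⟨x,y⟩/‖x‖²)`
(p. 29; any real here). [cite: ChenQuantumLattice2024, §3.5.6–3.5.7 p. 27–31] -/
structure Data (ι : Type*) where
  tsq : ℝ
  M : ℝ
  D : ℝ
  x : ι → ℝ
  y : ι → ℝ
  z' : ι → ℝ
  hs : ι → ℝ
  y' : ι → ℝ
  v : ι → ℝ
  kr : ℝ

namespace Data

variable (Γ : Data ι)

/-- `‖x‖²`. [cite: ChenQuantumLattice2024, eq. (27) p. 27] -/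
def nx : ℝ := Γ.x ⬝ᵥ Γ.x
/-- `t² + ‖x‖²` (`= t² + u² = M/2` under the correct guess, C.2). [cite: ChenQuantumLattice2024, Cond. C.2 p. 18] -/
def S : ℝ := Γ.tsq + Γ.nx
/-- `θ′ := ⟨x,y⟩/‖x‖² − ⟨x,z′⟩/(t²+‖x‖²)`, the scalar in `c′`. [cite: ChenQuantumLattice2024, eq. (27) p. 27] -/
def theta : ℝ := (Γ.x ⬝ᵥ Γ.y) / Γ.nx - (Γ.x ⬝ᵥ Γ.z') / Γ.S
/-- `c′ := c + z′ + h* − y + θ′·x`. [cite: ChenQuantumLattice2024, eq. (27) p. 27] -/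
def cPrime (c : ι → ℝ) : ι → ℝ := c + Γ.z' + Γ.hs - Γ.y + Γ.theta • Γ.x
/-- `a(c) := c + z′ − (⟨x,z′⟩/(t²+‖x‖²))·x`, the vector in the first two factors of `e^{2πiφ₆}`.
[cite: ChenQuantumLattice2024, eq. (28) p. 27] -/
def aVec (c : ι → ℝ) : ι → ℝ := c + Γ.z' - ((Γ.x ⬝ᵥ Γ.z') / Γ.S) • Γ.x
/-- `W(c,k) := ⟨c′ − (M/2)k, x⟩`. [cite: ChenQuantumLattice2024, eq. (27)–(28) p. 27] -/
def W (c k : ι → ℝ) : ℝ := (Γ.cPrime c - (Γ.M / 2) • k) ⬝ᵥ Γ.x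
/-- `B(c,k) := ⟨c′ − (M/2)k, x⟩/‖x‖² − ⟨h* − (M/2)k, x⟩/(t²+‖x‖²)`, the inner bracket of eq. (27)/(28).
[cite: ChenQuantumLattice2024, eq. (27)–(28) p. 27] -/
def B (c k : ι → ℝ) : ℝ := Γ.W c k / Γ.nx - ((Γ.hs - (Γ.M / 2) • k) ⬝ᵥ Γ.x) / Γ.S
/-- **`φ₆(c,k,j)` of eq. (28), verbatim**:
`e^{2πiφ₆} = e^{2πi kᵀ a/M} · e^{−2πi ‖a‖²/M²} · e^{−2πi (W/(M‖x‖²))·(2Dj − B)} · e^{−2πi t² W²/(M²‖x‖⁴)}`.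
[cite: ChenQuantumLattice2024, eq. (28) p. 27] -/
def phi6 (c k : ι → ℝ) (j : ℝ) : ℝ :=
  (k ⬝ᵥ Γ.aVec c) / Γ.M - (Γ.aVec c ⬝ᵥ Γ.aVec c) / Γ.M ^ 2
    - Γ.W c k / (Γ.M * Γ.nx) * (2 * Γ.D * j - Γ.B c k)
    - Γ.tsq * Γ.W c k ^ 2 / (Γ.M ^ 2 * Γ.nx ^ 2)
/-- `θ″ := ⟨z′+h*,x⟩/(t²+‖x‖²) − ⟨y,x⟩/‖x‖²`, the scalar in the centres (29) (`k′ = round θ″`, p. 29).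
[cite: ChenQuantumLattice2024, eq. (29) p. 28] -/
def theta2 : ℝ := ((Γ.z' + Γ.hs) ⬝ᵥ Γ.x) / Γ.S - (Γ.y ⬝ᵥ Γ.x) / Γ.nx
/-- The centre of eq. (29): `(M/2)k − (z′+h*−y) − x⟨x,k⟩ + 2Dj·x + θ″·x`. [cite: ChenQuantumLattice2024, eq. (29) p. 28] -/
def ctr (k : ι → ℝ) (j : ℝ) : ι → ℝ :=
  (Γ.M / 2) • k - (Γ.z' + Γ.hs - Γ.y) - (Γ.x ⬝ᵥ k) • Γ.x + (2 * Γ.D * j) • Γ.x + Γ.theta2 • Γ.x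
/-- `Π_⊥ w := (Iₙ − xxᵀ/‖x‖²) w = w − (⟨w,x⟩/‖x‖²)·x`. [cite: ChenQuantumLattice2024, Lemma 3.28 p. 48; eq. (27) p. 27] -/
def perp (w : ι → ℝ) : ι → ℝ := w - ((w ⬝ᵥ Γ.x) / Γ.nx) • Γ.x
/-- `u₁(c,k) := Π_⊥(c′ − (M/2)k)` — the argument of the first Gaussian factor `e^{−π‖u₁‖²/σ²}` of eq. (27).
[cite: ChenQuantumLattice2024, eq. (27) p. 27] -/
def u1 (c k : ι → ℝ) : ι → ℝ := Γ.perp (Γ.cPrime c - (Γ.M / 2) • k)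
/-- `u₂(c,k,j) := 2Dj − B(c,k)` — the second Gaussian factor of eq. (27) is `e^{−(π/σ_x²)‖u₂·x‖²}`, and `u₂`
is also the bracket of the third phase factor of (28). [cite: ChenQuantumLattice2024, eq. (27)–(28) p. 27] -/
def u2 (c k : ι → ℝ) (j : ℝ) : ℝ := 2 * Γ.D * j - Γ.B c k
/-- `u₃(c,k,j) := centre(k,j) − c` — the support window of eq. (27) is `‖u₃‖_∞ ≤ σ log n`.
[cite: ChenQuantumLattice2024, eq. (27), (29) p. 27–28] -/
def u3 (c k : ι → ℝ) (j : ℝ) : ι → ℝ := Γ.ctr k j - c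
/-- The eq. (27) summand for an ARBITRARY envelope `g(u₁,u₂,u₃)`: `g(u₁,u₂,u₃) · e^{2πiφ₆(c,k,j)}`.
[cite: ChenQuantumLattice2024, eq. (27)–(28) p. 27] -/
def term (g : (ι → ℝ) → ℝ → (ι → ℝ) → ℂ) (c k : ι → ℝ) (j : ℝ) : ℂ :=
  g (Γ.u1 c k) (Γ.u2 c k j) (Γ.u3 c k j) * Complex.exp (2 * Real.pi * Complex.I * (Γ.phi6 c k j : ℝ))

open Classical in
/-- The envelope actually displayed in eq. (27): window `‖u₃‖_∞ ≤ σ log n`, `e^{−π‖u₁‖²/σ²}`,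
`e^{−(π/σ_x²)‖u₂x‖²}` (`‖u₂x‖² = u₂²‖x‖²`; `σ_x² ∈ ℂ`, Lemma 3.28). [cite: ChenQuantumLattice2024, eq. (27) p. 27] -/
def env27 (σsq bound : ℝ) (σxsq : ℂ) (u₁ : ι → ℝ) (u₂ : ℝ) (u₃ : ι → ℝ) : ℂ :=
  (if ∀ t, |u₃ t| ≤ bound then 1 else 0) * ((Real.exp (-Real.pi * (u₁ ⬝ᵥ u₁) / σsq) : ℝ) : ℂ)
    * Complex.exp (-(Real.pi : ℂ) / σxsq * ((u₂ ^ 2 * Γ.nx : ℝ) : ℂ))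

/-! ### eq. (30): regrouping the first two phase factors -/

/-- Eq. (30): `kᵀa/M − ‖a‖²/M² = −‖a − (M/2)k‖²/M² + ‖k‖²/4` (`M ≠ 0`), so
`e^{2πiφ₆} = I₁ · e^{2πi‖k‖²/4} · I₂ · I₃`. [cite: ChenQuantumLattice2024, eq. (30) p. 28] -/
theorem eq30_regroup (hM : Γ.M ≠ 0) (c k : ι → ℝ) (j : ℝ) :
    Γ.phi6 c k j = -((Γ.aVec c - (Γ.M / 2) • k) ⬝ᵥ (Γ.aVec c - (Γ.M / 2) • k)) / Γ.M ^ 2 + (k ⬝ᵥ k) / 4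
      - Γ.W c k / (Γ.M * Γ.nx) * Γ.u2 c k j - Γ.tsq * Γ.W c k ^ 2 / (Γ.M ^ 2 * Γ.nx ^ 2) := by
  simp only [phi6, u2, sub_dotProduct, dotProduct_sub, smul_dotProduct, dotProduct_smul, smul_eq_mul,
    dotProduct_comm k (Γ.aVec c)]
  field_simp
  ring

/-- `Π_⊥(w + λx) = Π_⊥ w` (`‖x‖² ≠ 0`). [folklore] -/
theorem perp_add_smul (hnx : Γ.nx ≠ 0) (w : ι → ℝ) (l : ℝ) : Γ.perp (w + l • Γ.x) = Γ.perp w := by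
  have hnx' : Γ.x ⬝ᵥ Γ.x ≠ 0 := hnx
  ext t
  simp only [perp, nx, add_dotProduct, smul_dotProduct, smul_eq_mul, Pi.add_apply, Pi.sub_apply,
    Pi.smul_apply]
  field_simp
  ring

/-! ## 5. Step 6: `M`-periodicity of the displayed `f₆` (remark p. 28–29), term by term

"We write `|φ‴₆⟩ = Σ_{c∈ℤⁿ} f₆(c)|c mod M⟩` instead of `Σ_{c∈ℤ_Mⁿ} f₆(c)|c⟩` in Eqn. (27). We can do so because the
amplitude function `f₆` is `M`-periodic" (p. 28–29; the paper argues from `|φ₆⟩ = QFT_{ℤ_Mⁿ}|φ₅⟩`).  Here the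
DISPLAYED (approximated) sum (27) is shown to be exactly `M`-periodic in its own right.  Shift `c ↦ c + M·eᵢ`.
TAIL coordinate `i` (where `kᵢ` is free): re-index `(k, j) ↦ (k + 2eᵢ, j + xᵢ/D)`.  HEAD coordinate `i₀` (where
`k_{i₀} = 0`, `b_{i₀} = −1`, i.e. `x_{i₀} = −D`): re-index `(k, j) ↦ (k + (2/D)x + 2e_{i₀}, j − 1 − t²/D²)`.  Under
`M = 2(t²+‖x‖²)` the three envelope arguments are invariant and `φ₆` moves by `kᵢ + 1`, resp.
`k_{i₀} + 2j − 1 − t²/D²` — an INTEGER exactly when `k ∈ ℤⁿ`, `j ∈ ℤ` and `t²/D² ∈ ℤ` (C.1: `t² = c·u² = c·D²‖b‖²`,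
`c ∈ 4ℤ`, "only used in Lemma 3.27 in Step 6", p. 18).  The re-indexing maps `0|ℤⁿ⁻¹ × ℤ` to itself exactly when
`x ∈ Dℤⁿ` (`x = Db`) and `t²/D² ∈ ℤ`. -/

section General

variable (c k : ι → ℝ) (j : ℝ)

/-- `a(c + w) = a(c) + w`. [cite: ChenQuantumLattice2024, eq. (28) p. 27] -/
theorem aVec_add (w : ι → ℝ) : Γ.aVec (c + w) = Γ.aVec c + w := by
  ext t; simp only [aVec, Pi.add_apply, Pi.sub_apply, Pi.smul_apply, smul_eq_mul]; ring

/-- `W = ⟨a,x⟩ + ⟨h*,x⟩ − (M/2)⟨k,x⟩` (uses `‖x‖² ≠ 0`: the `y`-parts of `c′` cancel against `θ′x`).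
[cite: ChenQuantumLattice2024, eq. (27)–(28) p. 27] -/
theorem W_eq_aVec (hnx : Γ.nx ≠ 0) :
    Γ.W c k = Γ.aVec c ⬝ᵥ Γ.x + Γ.hs ⬝ᵥ Γ.x - Γ.M / 2 * (k ⬝ᵥ Γ.x) := by
  have hnx' : Γ.x ⬝ᵥ Γ.x ≠ 0 := hnx
  have hc : Γ.cPrime c = Γ.aVec c + Γ.hs - Γ.y + ((Γ.x ⬝ᵥ Γ.y) / Γ.nx) • Γ.x := by
    ext t; simp only [cPrime, aVec, theta, Pi.add_apply, Pi.sub_apply, Pi.smul_apply, smul_eq_mul]; ring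
  rw [W, hc]
  simp only [nx, add_dotProduct, sub_dotProduct, smul_dotProduct, smul_eq_mul, dotProduct_comm Γ.y Γ.x]
  field_simp
  ring

/-- `φ₆` with its third factor written through `u₂ = 2Dj − B`. [cite: ChenQuantumLattice2024, eq. (28) p. 27] -/
theorem phi6_eq_u2 : Γ.phi6 c k j = (k ⬝ᵥ Γ.aVec c) / Γ.M - (Γ.aVec c ⬝ᵥ Γ.aVec c) / Γ.M ^ 2
    - Γ.W c k / (Γ.M * Γ.nx) * Γ.u2 c k j - Γ.tsq * Γ.W c k ^ 2 / (Γ.M ^ 2 * Γ.nx ^ 2) := by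
  simp only [phi6, u2]

/-- `u₂ = 2Dj − W/‖x‖² + (⟨h*,x⟩ − (M/2)⟨k,x⟩)/(t²+‖x‖²)`. [cite: ChenQuantumLattice2024, eq. (27)–(28) p. 27] -/
theorem u2_eq_W : Γ.u2 c k j
    = 2 * Γ.D * j - Γ.W c k / Γ.nx + (Γ.hs ⬝ᵥ Γ.x - Γ.M / 2 * (k ⬝ᵥ Γ.x)) / Γ.S := by
  simp only [u2, B, sub_dotProduct, smul_dotProduct, smul_eq_mul]
  ring

end General

section Tail

variable [DecidableEq ι] (i : ι) (c k : ι → ℝ) (j : ℝ)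

/-- Tail shift: `c′ − (M/2)k` is invariant under `(c,k) ↦ (c + M eᵢ, k + 2eᵢ)`.
[cite: ChenQuantumLattice2024, eq. (27) p. 27; remark p. 28–29] -/
theorem cPrime_sub_shift_tail :
    Γ.cPrime (c + Γ.M • Pi.single i 1) - (Γ.M / 2) • (k + (2 : ℝ) • Pi.single i 1)
      = Γ.cPrime c - (Γ.M / 2) • k := by
  ext t
  simp only [cPrime, Pi.add_apply, Pi.sub_apply, Pi.smul_apply, smul_eq_mul]
  ring

/-- `W` is invariant under the tail shift. [cite: ChenQuantumLattice2024, eq. (27)–(28) p. 27] -/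
theorem W_shift_tail : Γ.W (c + Γ.M • Pi.single i 1) (k + (2 : ℝ) • Pi.single i 1) = Γ.W c k := by
  simp only [W, cPrime_sub_shift_tail]

/-- `u₁` is invariant under the tail shift. [cite: ChenQuantumLattice2024, eq. (27) p. 27] -/
theorem u1_shift_tail : Γ.u1 (c + Γ.M • Pi.single i 1) (k + (2 : ℝ) • Pi.single i 1) = Γ.u1 c k := by
  simp only [u1, cPrime_sub_shift_tail]

/-- `B` moves by `M·xᵢ/(t²+‖x‖²)` under the tail shift (no hypothesis). [cite: ChenQuantumLattice2024, eq. (27) p. 27] -/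
theorem B_shift_tail :
    Γ.B (c + Γ.M • Pi.single i 1) (k + (2 : ℝ) • Pi.single i 1) = Γ.B c k + Γ.M * Γ.x i / Γ.S := by
  have hv : Γ.hs - (Γ.M / 2) • (k + (2 : ℝ) • Pi.single i 1)
      = (Γ.hs - (Γ.M / 2) • k) - Γ.M • Pi.single i 1 := by
    ext t; simp only [Pi.add_apply, Pi.sub_apply, Pi.smul_apply, smul_eq_mul]; ring
  simp only [B, W_shift_tail, hv, sub_dotProduct (Γ.hs - (Γ.M / 2) • k), smul_dotProduct,
    single_dotProduct, one_mul, smul_eq_mul]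
  ring

/-- GENERAL form: under the tail re-indexing `u₂` moves by `(2 − M/(t²+‖x‖²))·xᵢ` — it is invariant EXACTLY
because `M = 2(t² + ‖x‖²)`, i.e. because the guess `u² = ‖x‖²` behind C.2 is correct (or `xᵢ = 0`).
[cite: ChenQuantumLattice2024, eq. (27) p. 27; Cond. C.2 p. 18] -/
theorem u2_shift_tail_general (hD : Γ.D ≠ 0) :
    Γ.u2 (c + Γ.M • Pi.single i 1) (k + (2 : ℝ) • Pi.single i 1) (j + Γ.x i / Γ.D)
      = Γ.u2 c k j + (2 - Γ.M / Γ.S) * Γ.x i := by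
  simp only [u2, B_shift_tail]
  field_simp
  ring

/-- `u₂` is invariant under the tail re-indexing when `M = 2(t²+‖x‖²)`.
[cite: ChenQuantumLattice2024, eq. (27) p. 27; Cond. C.2 p. 18] -/
theorem u2_shift_tail (hD : Γ.D ≠ 0) (hS : Γ.S ≠ 0) (hM : Γ.M = 2 * Γ.S) :
    Γ.u2 (c + Γ.M • Pi.single i 1) (k + (2 : ℝ) • Pi.single i 1) (j + Γ.x i / Γ.D) = Γ.u2 c k j := by
  rw [Γ.u2_shift_tail_general i c k j hD, hM]
  field_simp
  ring

/-- `u₃ = centre − c` is invariant under the tail re-indexing (no hypothesis beyond `D ≠ 0`).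
[cite: ChenQuantumLattice2024, eq. (29) p. 28] -/
theorem u3_shift_tail (hD : Γ.D ≠ 0) :
    Γ.u3 (c + Γ.M • Pi.single i 1) (k + (2 : ℝ) • Pi.single i 1) (j + Γ.x i / Γ.D) = Γ.u3 c k j := by
  ext t
  simp only [u3, ctr, dotProduct_add, dotProduct_smul, dotProduct_single, mul_one, smul_eq_mul,
    Pi.add_apply, Pi.sub_apply, Pi.smul_apply]
  field_simp
  ring

/-- **`φ₆` moves by EXACTLY `kᵢ + 1` under the tail re-indexing** (given `M = 2(t²+‖x‖²)`, `D, ‖x‖²,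
t²+‖x‖² ≠ 0`). [cite: ChenQuantumLattice2024, eq. (28) p. 27; remark p. 28–29] -/
theorem phi6_shift_tail (hD : Γ.D ≠ 0) (hnx : Γ.nx ≠ 0) (hS : Γ.S ≠ 0) (hM : Γ.M = 2 * Γ.S) :
    Γ.phi6 (c + Γ.M • Pi.single i 1) (k + (2 : ℝ) • Pi.single i 1) (j + Γ.x i / Γ.D)
      = Γ.phi6 c k j + (k i + 1) := by
  have hM0 : Γ.M ≠ 0 := by rw [hM]; exact mul_ne_zero two_ne_zero hS
  have hu2 := Γ.u2_shift_tail i c k j hD hS hM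
  simp only [u2] at hu2
  rw [phi6, phi6, Γ.W_shift_tail, hu2, Γ.aVec_add]
  simp only [add_dotProduct, dotProduct_add, smul_dotProduct, dotProduct_smul, single_dotProduct,
    dotProduct_single, Pi.add_apply, Pi.smul_apply, Pi.single_eq_same, mul_one, one_mul, smul_eq_mul]
  field_simp
  ring

/-- Hence every eq. (27)-shaped summand `g(u₁,u₂,u₃)e^{2πiφ₆}` — for ANY envelope `g` — is invariant under the
tail re-indexing when `kᵢ ∈ ℤ`. [cite: ChenQuantumLattice2024, eq. (27) p. 27; remark p. 28–29] -/
theorem term_shift_tail (g : (ι → ℝ) → ℝ → (ι → ℝ) → ℂ) (hD : Γ.D ≠ 0) (hnx : Γ.nx ≠ 0) (hS : Γ.S ≠ 0)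
    (hM : Γ.M = 2 * Γ.S) (hk : ∃ m : ℤ, k i = m) :
    Γ.term g (c + Γ.M • Pi.single i 1) (k + (2 : ℝ) • Pi.single i 1) (j + Γ.x i / Γ.D) = Γ.term g c k j := by
  obtain ⟨m, hm⟩ := hk
  simp only [term, Γ.u1_shift_tail, Γ.u2_shift_tail i c k j hD hS hM, Γ.u3_shift_tail i c k j hD,
    Γ.phi6_shift_tail i c k j hD hnx hS hM]
  congr 1
  exact cexp_two_pi_mul_I_eq_of_sub_int (m + 1) (by rw [hm]; push_cast; ring)

end Tail

section Head

variable [DecidableEq ι] (i₀ : ι) (c k : ι → ℝ) (j : ℝ)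

/-- Head shift: `c′ − (M/2)k` moves by `−(M/D)·x` under `(c,k) ↦ (c + M e_{i₀}, k + (2/D)x + 2e_{i₀})` (the
`e_{i₀}` parts cancel; no hypothesis on `x_{i₀}`). [cite: ChenQuantumLattice2024, eq. (27) p. 27; remark p. 28–29] -/
theorem cPrime_sub_shift_head (hD : Γ.D ≠ 0) :
    Γ.cPrime (c + Γ.M • Pi.single i₀ 1) - (Γ.M / 2) • (k + (2 / Γ.D) • Γ.x + (2 : ℝ) • Pi.single i₀ 1)
      = (Γ.cPrime c - (Γ.M / 2) • k) + (-(Γ.M / Γ.D)) • Γ.x := by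
  ext t
  simp only [cPrime, Pi.add_apply, Pi.sub_apply, Pi.smul_apply, smul_eq_mul]
  field_simp
  ring

/-- `u₁` is invariant under the head re-indexing (`‖x‖² ≠ 0`). [cite: ChenQuantumLattice2024, eq. (27) p. 27] -/
theorem u1_shift_head (hD : Γ.D ≠ 0) (hnx : Γ.nx ≠ 0) :
    Γ.u1 (c + Γ.M • Pi.single i₀ 1) (k + (2 / Γ.D) • Γ.x + (2 : ℝ) • Pi.single i₀ 1) = Γ.u1 c k := by
  simp only [u1, Γ.cPrime_sub_shift_head i₀ c k hD, Γ.perp_add_smul hnx]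

/-- `W` moves by `−(M/D)‖x‖²` under the head re-indexing. [cite: ChenQuantumLattice2024, eq. (27)–(28) p. 27] -/
theorem W_shift_head (hD : Γ.D ≠ 0) :
    Γ.W (c + Γ.M • Pi.single i₀ 1) (k + (2 / Γ.D) • Γ.x + (2 : ℝ) • Pi.single i₀ 1)
      = Γ.W c k - Γ.M / Γ.D * Γ.nx := by
  simp only [W, nx, Γ.cPrime_sub_shift_head i₀ c k hD, add_dotProduct, smul_dotProduct, smul_eq_mul]
  ring

/-- `B` moves by `−M/D + M(‖x‖²/D − D)/(t²+‖x‖²)` under the head re-indexing (`x_{i₀} = −D`).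
[cite: ChenQuantumLattice2024, eq. (27) p. 27; eq. (12) p. 17] -/
theorem B_shift_head (hD : Γ.D ≠ 0) (hnx : Γ.nx ≠ 0) (hx0 : Γ.x i₀ = -Γ.D) :
    Γ.B (c + Γ.M • Pi.single i₀ 1) (k + (2 / Γ.D) • Γ.x + (2 : ℝ) • Pi.single i₀ 1)
      = Γ.B c k - Γ.M / Γ.D + Γ.M * (Γ.nx / Γ.D - Γ.D) / Γ.S := by
  have hnx' : Γ.x ⬝ᵥ Γ.x ≠ 0 := hnx
  have hnxdef : Γ.x ⬝ᵥ Γ.x = Γ.nx := rfl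
  have hv : Γ.hs - (Γ.M / 2) • (k + (2 / Γ.D) • Γ.x + (2 : ℝ) • Pi.single i₀ 1)
      = (Γ.hs - (Γ.M / 2) • k) - (Γ.M / Γ.D) • Γ.x - Γ.M • Pi.single i₀ 1 := by
    ext t; simp only [Pi.add_apply, Pi.sub_apply, Pi.smul_apply, smul_eq_mul]; field_simp; ring
  rw [B, B, Γ.W_shift_head i₀ c k hD, hv]
  simp only [sub_dotProduct, smul_dotProduct, single_dotProduct, one_mul, smul_eq_mul, hx0, hnxdef]
  field_simp
  ring

/-- GENERAL form: under the head re-indexing `u₂` moves by `(M/(t²+‖x‖²) − 2)(t² + D²)/D` — invariant iff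
`M = 2(t²+‖x‖²)` (the correct guess) or `t² + D² = 0`. [cite: ChenQuantumLattice2024, eq. (27) p. 27; Cond. C.2 p. 18] -/
theorem u2_shift_head_general (hD : Γ.D ≠ 0) (hnx : Γ.nx ≠ 0) (hS : Γ.S ≠ 0) (hx0 : Γ.x i₀ = -Γ.D) :
    Γ.u2 (c + Γ.M • Pi.single i₀ 1) (k + (2 / Γ.D) • Γ.x + (2 : ℝ) • Pi.single i₀ 1) (j - 1 - Γ.tsq / Γ.D ^ 2)
      = Γ.u2 c k j + (Γ.M / Γ.S - 2) * (Γ.tsq + Γ.D ^ 2) / Γ.D := by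
  have hSdef : Γ.tsq + Γ.nx = Γ.S := rfl
  have hS' : Γ.tsq + Γ.nx ≠ 0 := hS
  simp only [u2, Γ.B_shift_head i₀ c k hD hnx hx0]
  rw [← hSdef]
  field_simp
  ring

/-- `u₂` is invariant under the head re-indexing when `M = 2(t²+‖x‖²)` and `x_{i₀} = −D`.
[cite: ChenQuantumLattice2024, eq. (27) p. 27; Cond. C.2 p. 18; eq. (12) p. 17] -/
theorem u2_shift_head (hD : Γ.D ≠ 0) (hnx : Γ.nx ≠ 0) (hS : Γ.S ≠ 0) (hM : Γ.M = 2 * Γ.S)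
    (hx0 : Γ.x i₀ = -Γ.D) :
    Γ.u2 (c + Γ.M • Pi.single i₀ 1) (k + (2 / Γ.D) • Γ.x + (2 : ℝ) • Pi.single i₀ 1) (j - 1 - Γ.tsq / Γ.D ^ 2)
      = Γ.u2 c k j := by
  rw [Γ.u2_shift_head_general i₀ c k j hD hnx hS hx0, hM]
  field_simp
  ring

/-- GENERAL form: under the head re-indexing `u₃` moves by `((M − 2(t²+‖x‖²))/D)·x` — invariant iff
`M = 2(t²+‖x‖²)`. [cite: ChenQuantumLattice2024, eq. (29) p. 28; Cond. C.2 p. 18; eq. (12) p. 17] -/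
theorem u3_shift_head_general (hD : Γ.D ≠ 0) (hx0 : Γ.x i₀ = -Γ.D) :
    Γ.u3 (c + Γ.M • Pi.single i₀ 1) (k + (2 / Γ.D) • Γ.x + (2 : ℝ) • Pi.single i₀ 1) (j - 1 - Γ.tsq / Γ.D ^ 2)
      = Γ.u3 c k j + ((Γ.M - 2 * Γ.S) / Γ.D) • Γ.x := by
  have hnxdef : Γ.x ⬝ᵥ Γ.x = Γ.nx := rfl
  ext t
  simp only [u3, ctr, S, dotProduct_add, dotProduct_smul, dotProduct_single, mul_one, smul_eq_mul,
    Pi.add_apply, Pi.sub_apply, Pi.smul_apply, hnxdef, hx0]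
  field_simp
  ring

/-- `u₃` is invariant under the head re-indexing when `M = 2(t²+‖x‖²)` and `x_{i₀} = −D`.
[cite: ChenQuantumLattice2024, eq. (29) p. 28; Cond. C.2 p. 18; eq. (12) p. 17] -/
theorem u3_shift_head (hD : Γ.D ≠ 0) (hM : Γ.M = 2 * Γ.S) (hx0 : Γ.x i₀ = -Γ.D) :
    Γ.u3 (c + Γ.M • Pi.single i₀ 1) (k + (2 / Γ.D) • Γ.x + (2 : ℝ) • Pi.single i₀ 1) (j - 1 - Γ.tsq / Γ.D ^ 2)
      = Γ.u3 c k j := by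
  rw [Γ.u3_shift_head_general i₀ c k j hD hx0, hM, sub_self, zero_div, zero_smul, add_zero]

/-- **`φ₆` moves by EXACTLY `k_{i₀} + 2j − 1 − t²/D²` under the head re-indexing** (given `M = 2(t²+‖x‖²)`,
`x_{i₀} = −D`, `D, ‖x‖², t²+‖x‖² ≠ 0`). [cite: ChenQuantumLattice2024, eq. (28) p. 27; remark p. 28–29; Cond. C.1 p. 18] -/
theorem phi6_shift_head (hD : Γ.D ≠ 0) (hnx : Γ.nx ≠ 0) (hS : Γ.S ≠ 0) (hM : Γ.M = 2 * Γ.S)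
    (hx0 : Γ.x i₀ = -Γ.D) :
    Γ.phi6 (c + Γ.M • Pi.single i₀ 1) (k + (2 / Γ.D) • Γ.x + (2 : ℝ) • Pi.single i₀ 1) (j - 1 - Γ.tsq / Γ.D ^ 2)
      = Γ.phi6 c k j + (k i₀ + 2 * j - 1 - Γ.tsq / Γ.D ^ 2) := by
  have hM0 : Γ.M ≠ 0 := by rw [hM]; exact mul_ne_zero two_ne_zero hS
  have hnxdef : Γ.x ⬝ᵥ Γ.x = Γ.nx := rfl
  rw [phi6_eq_u2, phi6_eq_u2, Γ.u2_shift_head i₀ c k j hD hnx hS hM hx0, Γ.W_shift_head i₀ c k hD,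
    Γ.aVec_add, Γ.u2_eq_W, Γ.W_eq_aVec c k hnx]
  simp only [add_dotProduct, dotProduct_add, smul_dotProduct, dotProduct_smul, single_dotProduct,
    dotProduct_single, Pi.add_apply, Pi.smul_apply, Pi.single_eq_same, mul_one, one_mul, smul_eq_mul, hx0,
    dotProduct_comm Γ.x (Γ.aVec c)]
  have hS' : Γ.S = Γ.tsq + Γ.nx := rfl
  rw [hM, hS'] at *
  have hSnz : Γ.tsq + Γ.nx ≠ 0 := hS
  field_simp
  ring

/-- Hence every eq. (27)-shaped summand — ANY envelope `g` — is invariant under the head re-indexing when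
`k_{i₀} = 0`, `j ∈ ℤ` and `t²/D² ∈ ℤ` (C.1). [cite: ChenQuantumLattice2024, eq. (27) p. 27; remark p. 28–29; Cond. C.1 p. 18] -/
theorem term_shift_head (g : (ι → ℝ) → ℝ → (ι → ℝ) → ℂ) (hD : Γ.D ≠ 0) (hnx : Γ.nx ≠ 0) (hS : Γ.S ≠ 0)
    (hM : Γ.M = 2 * Γ.S) (hx0 : Γ.x i₀ = -Γ.D) (hk0 : k i₀ = 0) (jz : ℤ) (hj : j = jz)
    (hC1 : ∃ τ : ℤ, Γ.tsq = Γ.D ^ 2 * τ) :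
    Γ.term g (c + Γ.M • Pi.single i₀ 1) (k + (2 / Γ.D) • Γ.x + (2 : ℝ) • Pi.single i₀ 1)
      (j - 1 - Γ.tsq / Γ.D ^ 2) = Γ.term g c k j := by
  obtain ⟨τ, hτ⟩ := hC1
  simp only [term, Γ.u1_shift_head i₀ c k hD hnx, Γ.u2_shift_head i₀ c k j hD hnx hS hM hx0,
    Γ.u3_shift_head i₀ c k j hD hM hx0, Γ.phi6_shift_head i₀ c k j hD hnx hS hM hx0]
  congr 1
  refine cexp_two_pi_mul_I_eq_of_sub_int (2 * jz - 1 - τ) ?_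
  rw [hk0, hj, hτ]
  push_cast
  field_simp
  ring

end Head

/-! ### The displayed `f₆`, summed over `k ∈ 0|ℤⁿ⁻¹`, `j ∈ ℤ`, is `M`-periodic -/

section Sum

variable [DecidableEq ι] (i₀ : ι)

/-- Translation of the index set `{k ∈ ℤⁿ : k_{i₀} = 0} × ℤ` by `(w, s)` with `w_{i₀} = 0`. [folklore] -/
def shiftEquiv (w : ι → ℤ) (hw : w i₀ = 0) (s : ℤ) :
    {k : ι → ℤ // k i₀ = 0} × ℤ ≃ {k : ι → ℤ // k i₀ = 0} × ℤ where
  toFun p := (⟨p.1.1 + w, by simp [p.1.2, hw]⟩, p.2 + s)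
  invFun p := (⟨p.1.1 - w, by simp [p.1.2, hw]⟩, p.2 - s)
  left_inv p := by
    rcases p with ⟨⟨k, hk⟩, j⟩
    simp
  right_inv p := by
    rcases p with ⟨⟨k, hk⟩, j⟩
    simp

/-- The displayed amplitude function of `|φ‴₆⟩` at `c ∈ ℤⁿ` read in `ℝⁿ`, for an envelope `g`:
`f₆(c) := Σ_{k ∈ 0|ℤⁿ⁻¹, j ∈ ℤ} g(u₁,u₂,u₃)·e^{2πiφ₆(c,k,j)}` (`0|ℤⁿ⁻¹` = `{k : k_{i₀} = 0}`; a `tsum` — no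
summability is needed below; for the eq. (27) envelope the window makes it a finite sum).
[cite: ChenQuantumLattice2024, eq. (27) p. 27] -/
def f6 (g : (ι → ℝ) → ℝ → (ι → ℝ) → ℂ) (c : ι → ℝ) : ℂ :=
  ∑' p : {k : ι → ℤ // k i₀ = 0} × ℤ, Γ.term g c (fun t => (p.1.1 t : ℝ)) (p.2 : ℝ)

variable (g : (ι → ℝ) → ℝ → (ι → ℝ) → ℂ) (b : ι → ℤ)

/-- **`f₆(c + M·eᵢ) = f₆(c)` for a tail coordinate `i ≠ i₀`**, given `x = D·b` (`b ∈ ℤⁿ`), `D ≠ 0`, `‖x‖² ≠ 0`,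
`t²+‖x‖² ≠ 0` and `M = 2(t²+‖x‖²)` — by the re-indexing `(k,j) ↦ (k + 2eᵢ, j + bᵢ)` of `0|ℤⁿ⁻¹ × ℤ`.
[cite: ChenQuantumLattice2024, remark p. 28–29; eq. (27) p. 27; Cond. C.2 p. 18] -/
theorem f6_periodic_tail (i : ι) (hi : i ≠ i₀) (hx : Γ.x = fun t => Γ.D * b t) (hD : Γ.D ≠ 0)
    (hnx : Γ.nx ≠ 0) (hS : Γ.S ≠ 0) (hM : Γ.M = 2 * Γ.S) (c : ι → ℝ) :
    Γ.f6 i₀ g (c + Γ.M • Pi.single i 1) = Γ.f6 i₀ g c := by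
  have hw : (Pi.single i (2 : ℤ) : ι → ℤ) i₀ = 0 := by simp [hi.symm]
  let τ := shiftEquiv i₀ (Pi.single i 2) hw (b i)
  unfold f6
  rw [← Equiv.tsum_eq τ]
  refine tsum_congr fun p => ?_
  have h1 : (fun t => (((τ p).1.1 t : ℤ) : ℝ)) = (fun t => (p.1.1 t : ℝ)) + (2 : ℝ) • Pi.single i 1 := by
    ext t
    simp only [τ, shiftEquiv, Equiv.coe_fn_mk, Pi.add_apply, Pi.smul_apply, Pi.single_apply, Int.cast_add,
      Int.cast_ite, Int.cast_ofNat, Int.cast_zero, smul_eq_mul]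
    split_ifs <;> simp
  have h2 : (((τ p).2 : ℤ) : ℝ) = (p.2 : ℝ) + Γ.x i / Γ.D := by
    simp only [τ, shiftEquiv, Equiv.coe_fn_mk, Int.cast_add, hx]
    field_simp
  rw [h1, h2]
  exact Γ.term_shift_tail i _ _ _ g hD hnx hS hM ⟨p.1.1 i, rfl⟩

/-- **`f₆(c + M·e_{i₀}) = f₆(c)` for the head coordinate**, given in addition `b_{i₀} = −1` (eq. (12)) and
`t² = D²·τ` with `τ ∈ ℤ` (C.1: `t² = c·D²‖b‖²`) — by the re-indexing `(k,j) ↦ (k + 2(b + e_{i₀}), j − 1 − τ)` of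
`0|ℤⁿ⁻¹ × ℤ`. [cite: ChenQuantumLattice2024, remark p. 28–29; eq. (27) p. 27; Cond. C.1–C.2 p. 18; eq. (12) p. 17] -/
theorem f6_periodic_head (hx : Γ.x = fun t => Γ.D * b t) (hb0 : b i₀ = -1) (τz : ℤ)
    (hC1 : Γ.tsq = Γ.D ^ 2 * τz) (hD : Γ.D ≠ 0) (hnx : Γ.nx ≠ 0) (hS : Γ.S ≠ 0) (hM : Γ.M = 2 * Γ.S)
    (c : ι → ℝ) :
    Γ.f6 i₀ g (c + Γ.M • Pi.single i₀ 1) = Γ.f6 i₀ g c := by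
  have hw : (fun t => 2 * b t + 2 * (Pi.single i₀ 1 : ι → ℤ) t) i₀ = 0 := by simp [hb0]
  let τ := shiftEquiv i₀ (fun t => 2 * b t + 2 * (Pi.single i₀ 1 : ι → ℤ) t) hw (-1 - τz)
  have hx0 : Γ.x i₀ = -Γ.D := by simp [hx, hb0]
  unfold f6
  rw [← Equiv.tsum_eq τ]
  refine tsum_congr fun p => ?_
  have h1 : (fun t => (((τ p).1.1 t : ℤ) : ℝ))
      = (fun t => (p.1.1 t : ℝ)) + (2 / Γ.D) • Γ.x + (2 : ℝ) • Pi.single i₀ 1 := by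
    ext t
    simp only [τ, shiftEquiv, Equiv.coe_fn_mk, Pi.add_apply, Pi.smul_apply, Pi.single_apply, smul_eq_mul, hx]
    push_cast
    split_ifs <;> field_simp <;> ring
  have h2 : (((τ p).2 : ℤ) : ℝ) = (p.2 : ℝ) - 1 - Γ.tsq / Γ.D ^ 2 := by
    simp only [τ, shiftEquiv, Equiv.coe_fn_mk, Int.cast_add, Int.cast_sub, Int.cast_neg, Int.cast_one, hC1]
    field_simp
    ring
  rw [h1, h2]
  exact Γ.term_shift_head i₀ _ _ _ g hD hnx hS hM hx0 (by simp [p.1.2]) p.2 rfl ⟨τz, hC1⟩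

end Sum

/-! ## 6. Step 7 (Lemma 3.11, §3.5.7 p. 29–31): eq. (31)–(33) and Claim 3.12, exactly -/

/-- The content subtracted from the register in the second operation, eq. (32):
`R(k,j) := (M/2)k + (2Dj − ⟨k,x⟩ + k′)x − v` ("`= (M/2)k − x⟨x,k⟩ + 2Djx + k′x − v`", eq. (31)).
[cite: ChenQuantumLattice2024, eq. (31)–(32) p. 29–30] -/
def R (k : ι → ℝ) (j : ℝ) : ι → ℝ := (Γ.M / 2) • k + (2 * Γ.D * j - k ⬝ᵥ Γ.x + Γ.kr) • Γ.x - Γ.v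
/-- `c` as a function of the register content `d := c + z′ + h* − y′ − R(k,j)` after eq. (32) (p. 30):
`c = d − z′ − h* + y′ + R(k,j)`. [cite: ChenQuantumLattice2024, eq. (32)–(33) p. 30] -/
def cOf (d k : ι → ℝ) (j : ℝ) : ι → ℝ := d - Γ.z' - Γ.hs + Γ.y' + Γ.R k j
/-- `E(d) := d − h* + y′ + k′x − v − (⟨x,z′⟩/(t²+‖x‖²))x` — the `(k,j)`-free part of `a − (M/2)k` (eq. (33) line 2).
[cite: ChenQuantumLattice2024, eq. (33) p. 30] -/
def E (d : ι → ℝ) : ι → ℝ := d - Γ.hs + Γ.y' + Γ.kr • Γ.x - Γ.v - ((Γ.x ⬝ᵥ Γ.z') / Γ.S) • Γ.x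
/-- `L(d) := −⟨E,x⟩/‖x‖² − t²⟨h*,x⟩/(‖x‖²(t²+‖x‖²))` — the common value of `u₂ = 2Dj − B` after Step 7 (minus
eq. (33) line 4). [cite: ChenQuantumLattice2024, eq. (33) p. 30] -/
def L (d : ι → ℝ) : ℝ := -(Γ.E d ⬝ᵥ Γ.x) / Γ.nx - Γ.tsq * (Γ.hs ⬝ᵥ Γ.x) / (Γ.nx * Γ.S)
/-- The `(k,j)`-free phase `Φ₀(d)` of Claim 3.12 (the "∝"): with `F := ⟨E,x⟩ + ⟨h*,x⟩`,
`Φ₀ := −‖E‖²/M² − F·L/(M‖x‖²) − t²F²/(M²‖x‖⁴)`. [cite: ChenQuantumLattice2024, Claim 3.12 p. 30–31] -/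
def Phi0 (d : ι → ℝ) : ℝ :=
  -(Γ.E d ⬝ᵥ Γ.E d) / Γ.M ^ 2 - (Γ.E d ⬝ᵥ Γ.x + Γ.hs ⬝ᵥ Γ.x) * Γ.L d / (Γ.M * Γ.nx)
    - Γ.tsq * (Γ.E d ⬝ᵥ Γ.x + Γ.hs ⬝ᵥ Γ.x) ^ 2 / (Γ.M ^ 2 * Γ.nx ^ 2)

section Step7

variable (d k : ι → ℝ) (j : ℝ)

/-- Eq. (31), the exact part (uses `y′ = v + y`): for `c = centre(k,j) + u` (eq. (29)),
`c + z′ + h* − y′ = R(k,j) + ((θ″ − k′)·x + u)`. [cite: ChenQuantumLattice2024, eq. (31) p. 29] -/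
theorem eq31_decomp (hy : Γ.y' = Γ.v + Γ.y) (u : ι → ℝ) :
    (Γ.ctr k j + u) + Γ.z' + Γ.hs - Γ.y' = Γ.R k j + ((Γ.theta2 - Γ.kr) • Γ.x + u) := by
  ext t
  simp only [ctr, R, hy, Pi.add_apply, Pi.sub_apply, Pi.smul_apply, smul_eq_mul, dotProduct_comm Γ.x k]
  ring

/-- Eq. (31)(b) ⇒ eq. (32): if `R(k,j) ∈ Dℤⁿ` and `‖(θ″ − k′)x + u‖_∞ < D/2` (p. 29: `|θ″ − k′|·‖x‖_∞ + σ log n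
≤ D/4 + σ log n < D/2` by C.6), then rounding `c + z′ + h* − y′` to `Dℤⁿ` returns `R(k,j)`, coordinatewise.
[cite: ChenQuantumLattice2024, eq. (31)–(32) p. 29–30; Cond. C.6 p. 19] -/
theorem eq31_round (hy : Γ.y' = Γ.v + Γ.y) (hD : 0 < Γ.D) (u : ι → ℝ)
    (hR : ∀ t, ∃ a : ℤ, Γ.R k j t = Γ.D * a) (hε : ∀ t, |((Γ.theta2 - Γ.kr) • Γ.x + u) t| < Γ.D / 2)
    (t : ι) :
    Γ.D * (round (((Γ.ctr k j + u) + Γ.z' + Γ.hs - Γ.y') t / Γ.D) : ℝ) = Γ.R k j t := by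
  rw [Γ.eq31_decomp k j hy u, Pi.add_apply]
  exact eq31b_round Γ.D hD _ _ (hR t) (hε t)

/-- `R(k,j) ∈ Dℤⁿ` ("`∈ Dℤⁿ`" under eq. (31)): for `x = Db`, `v = Dv₀` (`v ∈ L ⊂ Dℤⁿ`), `M = 2D²P′` (C.3),
`k, b, v₀ ∈ ℤⁿ`, `j, k′, D ∈ ℤ`. [cite: ChenQuantumLattice2024, eq. (31) p. 29; Cond. C.3 p. 18; eq. (12) p. 17] -/
theorem R_mem_DZ (Dz P' krz : ℤ) (b k v₀ : ι → ℤ) (j : ℤ) (hD : Γ.D = Dz)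
    (hM : Γ.M = 2 * Γ.D ^ 2 * P') (hx : Γ.x = fun t => Γ.D * b t) (hkr : Γ.kr = krz)
    (hv : Γ.v = fun t => Γ.D * v₀ t) (t : ι) :
    ∃ a : ℤ, Γ.R (fun t => (k t : ℝ)) j t = Γ.D * a := by
  refine ⟨Dz * P' * k t + (2 * Dz * j - Dz * (k ⬝ᵥ b) + krz) * b t - v₀ t, ?_⟩
  have hdot : (fun t => (k t : ℝ)) ⬝ᵥ Γ.x = Γ.D * ((k ⬝ᵥ b : ℤ) : ℝ) := by
    rw [hx]
    simp only [dotProduct, Int.cast_sum, Int.cast_mul, Finset.mul_sum]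
    refine Finset.sum_congr rfl fun i _ => ?_
    ring
  simp only [R, Pi.add_apply, Pi.sub_apply, Pi.smul_apply, smul_eq_mul]
  rw [hdot, hM, hkr]
  simp only [hx, hv, hD]
  push_cast
  ring

/-- Eq. (33) line 1 (uses `y′ = v + y`): `c′ − (M/2)k = 2Djx + d − (⟨k,x⟩ − k′)x + θ′x`.
[cite: ChenQuantumLattice2024, eq. (33) p. 30] -/
theorem eq33_line1 (hy : Γ.y' = Γ.v + Γ.y) :
    Γ.cPrime (Γ.cOf d k j) - (Γ.M / 2) • k
      = (2 * Γ.D * j) • Γ.x + d - (k ⬝ᵥ Γ.x - Γ.kr) • Γ.x + Γ.theta • Γ.x := by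
  ext t
  simp only [cPrime, cOf, R, hy, Pi.add_apply, Pi.sub_apply, Pi.smul_apply, smul_eq_mul]
  ring

/-- Eq. (33) line 1, collected: `c′ − (M/2)k = d + (2Dj − ⟨k,x⟩ + k′ + θ′)x`. [cite: ChenQuantumLattice2024, eq. (33) p. 30] -/
theorem eq33_line1' (hy : Γ.y' = Γ.v + Γ.y) :
    Γ.cPrime (Γ.cOf d k j) - (Γ.M / 2) • k = d + (2 * Γ.D * j - k ⬝ᵥ Γ.x + Γ.kr + Γ.theta) • Γ.x := by
  rw [Γ.eq33_line1 d k j hy]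
  ext t
  simp only [Pi.add_apply, Pi.sub_apply, Pi.smul_apply, smul_eq_mul]
  ring

/-- Eq. (33) line 1, consequence: `Π_⊥(c′ − (M/2)k) = Π_⊥ d` — the first Gaussian factor of (34) depends on `d`
only. [cite: ChenQuantumLattice2024, eq. (33)–(34) p. 30–31] -/
theorem eq33_perp (hnx : Γ.nx ≠ 0) (hy : Γ.y' = Γ.v + Γ.y) : Γ.u1 (Γ.cOf d k j) k = Γ.perp d := by
  rw [u1, Γ.eq33_line1' d k j hy, Γ.perp_add_smul hnx]

/-- Eq. (33) line 2, CORRECTED (no hypothesis; the printed line drops the vector `x` after `⟨x,z′⟩/(t²+‖x‖²)` —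
a typographical slip, both in `a` and in the result): `a − (M/2)k = d − (h* − y′) + (2Dj − ⟨k,x⟩ + k′)x − v
− (⟨x,z′⟩/(t²+‖x‖²))x`. [cite: ChenQuantumLattice2024, eq. (33) p. 30] -/
theorem eq33_line2 :
    Γ.aVec (Γ.cOf d k j) - (Γ.M / 2) • k
      = d - (Γ.hs - Γ.y') + (2 * Γ.D * j - k ⬝ᵥ Γ.x + Γ.kr) • Γ.x - Γ.v - ((Γ.x ⬝ᵥ Γ.z') / Γ.S) • Γ.x := by
  ext t
  simp only [aVec, cOf, R, Pi.add_apply, Pi.sub_apply, Pi.smul_apply, smul_eq_mul]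
  ring

/-- Eq. (33) line 2, collected: `a − (M/2)k = E(d) + (2Dj − ⟨k,x⟩)x`. [cite: ChenQuantumLattice2024, eq. (33) p. 30] -/
theorem eq33_line2' : Γ.aVec (Γ.cOf d k j) - (Γ.M / 2) • k = Γ.E d + (2 * Γ.D * j - k ⬝ᵥ Γ.x) • Γ.x := by
  ext t
  simp only [aVec, cOf, R, E, Pi.add_apply, Pi.sub_apply, Pi.smul_apply, smul_eq_mul]
  ring

/-- Eq. (33) line 3 (uses `y′ = v + y`, `‖x‖² ≠ 0`): `⟨c′ − (M/2)k, x⟩/‖x‖² = 2Dj − ⟨k,x⟩ + ⟨d,x⟩/‖x‖² −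
⟨v,x⟩/‖x‖² + k′ − ⟨z′,x⟩/(t²+‖x‖²) + ⟨y′,x⟩/‖x‖²`. [cite: ChenQuantumLattice2024, eq. (33) p. 30] -/
theorem eq33_line3 (hnx : Γ.nx ≠ 0) (hy : Γ.y' = Γ.v + Γ.y) :
    Γ.W (Γ.cOf d k j) k / Γ.nx = 2 * Γ.D * j - k ⬝ᵥ Γ.x + (d ⬝ᵥ Γ.x) / Γ.nx - (Γ.v ⬝ᵥ Γ.x) / Γ.nx + Γ.kr
      - (Γ.z' ⬝ᵥ Γ.x) / Γ.S + (Γ.y' ⬝ᵥ Γ.x) / Γ.nx := by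
  have hnx' : Γ.x ⬝ᵥ Γ.x ≠ 0 := hnx
  rw [W, Γ.eq33_line1' d k j hy]
  simp only [theta, nx, hy, add_dotProduct, smul_dotProduct, smul_eq_mul, dotProduct_comm Γ.x Γ.y,
    dotProduct_comm Γ.x Γ.z']
  field_simp
  ring

/-- `W` after Step 7, collected: `W = (2Dj − ⟨k,x⟩)‖x‖² + ⟨E,x⟩ + ⟨h*,x⟩` (`y′ = v + y`, `‖x‖² ≠ 0`).
[cite: ChenQuantumLattice2024, eq. (33) p. 30] -/
theorem W_cOf (hnx : Γ.nx ≠ 0) (hy : Γ.y' = Γ.v + Γ.y) :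
    Γ.W (Γ.cOf d k j) k = (2 * Γ.D * j - k ⬝ᵥ Γ.x) * Γ.nx + (Γ.E d ⬝ᵥ Γ.x + Γ.hs ⬝ᵥ Γ.x) := by
  have hnx' : Γ.x ⬝ᵥ Γ.x ≠ 0 := hnx
  rw [W, Γ.eq33_line1' d k j hy]
  simp only [theta, E, nx, hy, add_dotProduct, sub_dotProduct, smul_dotProduct, smul_eq_mul,
    dotProduct_comm Γ.x Γ.y, dotProduct_comm Γ.x Γ.z']
  field_simp
  ring

/-- Eq. (33) line 4 (uses `y′ = v + y` AND `M = 2(t²+‖x‖²)`): the bracket `B − 2Dj = −u₂` equals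
`⟨d,x⟩/‖x‖² − ⟨v,x⟩/‖x‖² + k′ − ⟨z′+h*,x⟩/(t²+‖x‖²) + ⟨y′,x⟩/‖x‖²`, independent of `(k,j)`.
[cite: ChenQuantumLattice2024, eq. (33) p. 30; Cond. C.2 p. 18] -/
theorem eq33_line4 (hnx : Γ.nx ≠ 0) (hS : Γ.S ≠ 0) (hM : Γ.M = 2 * Γ.S) (hy : Γ.y' = Γ.v + Γ.y) :
    Γ.W (Γ.cOf d k j) k / Γ.nx - ((Γ.hs - (Γ.M / 2) • k) ⬝ᵥ Γ.x) / Γ.S - 2 * Γ.D * j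
      = (d ⬝ᵥ Γ.x) / Γ.nx - (Γ.v ⬝ᵥ Γ.x) / Γ.nx + Γ.kr - ((Γ.z' + Γ.hs) ⬝ᵥ Γ.x) / Γ.S
        + (Γ.y' ⬝ᵥ Γ.x) / Γ.nx := by
  rw [Γ.eq33_line3 d k j hnx hy, hM]
  simp only [sub_dotProduct, add_dotProduct, smul_dotProduct, smul_eq_mul]
  field_simp
  ring

/-- GENERAL form of eq. (33) line 4: for ANY `M`, `u₂ = L(d) + (1 − M/(2(t²+‖x‖²)))⟨k,x⟩` after Step 7 — the
`k`-dependence disappears exactly when `M = 2(t²+‖x‖²)` (the correct guess).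
[cite: ChenQuantumLattice2024, eq. (33) p. 30; Cond. C.2 p. 18] -/
theorem u2_cOf_general (hnx : Γ.nx ≠ 0) (hS : Γ.S ≠ 0) (hy : Γ.y' = Γ.v + Γ.y) :
    Γ.u2 (Γ.cOf d k j) k j = Γ.L d + (1 - Γ.M / (2 * Γ.S)) * (k ⬝ᵥ Γ.x) := by
  have hnx' : Γ.x ⬝ᵥ Γ.x ≠ 0 := hnx
  have hS' : Γ.tsq + Γ.x ⬝ᵥ Γ.x ≠ 0 := hS
  rw [u2_eq_W, Γ.W_cOf d k j hnx hy, L]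
  simp only [nx, S]
  field_simp
  ring

/-- Consequently `u₂ = 2Dj − B = L(d)` after Step 7, for every `(k,j)`, when `M = 2(t²+‖x‖²)`.
[cite: ChenQuantumLattice2024, eq. (33) p. 30; Cond. C.2 p. 18] -/
theorem u2_cOf (hnx : Γ.nx ≠ 0) (hS : Γ.S ≠ 0) (hM : Γ.M = 2 * Γ.S) (hy : Γ.y' = Γ.v + Γ.y) :
    Γ.u2 (Γ.cOf d k j) k j = Γ.L d := by
  rw [Γ.u2_cOf_general d k j hnx hS hy, hM]
  have h2 : (2 : ℝ) * Γ.S ≠ 0 := mul_ne_zero two_ne_zero hS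
  rw [div_self h2, sub_self, zero_mul, add_zero]

/-- **Claim 3.12, exact form.**  With `c = c(d,k,j)` substituted, `φ₆(c,k,j) = Φ₀(d) − (2Dj − ⟨k,x⟩)²/(2M) + ‖k‖²/4`
(hypotheses: `y′ = v + y`, `M = 2(t²+‖x‖²)`, `‖x‖² ≠ 0`, `t²+‖x‖² ≠ 0`; NO integrality is used).  The
`(2Dj − ⟨k,x⟩)²` coefficient is `−(‖x‖² + t²)/M² = −1/(2M)` and the mixed `(2Dj − ⟨k,x⟩)¹` coefficient vanishes,
as on p. 31. [cite: ChenQuantumLattice2024, Claim 3.12 p. 30–31] -/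
theorem claim312_exact (hnx : Γ.nx ≠ 0) (hS : Γ.S ≠ 0) (hM : Γ.M = 2 * Γ.S) (hy : Γ.y' = Γ.v + Γ.y) :
    Γ.phi6 (Γ.cOf d k j) k j
      = Γ.Phi0 d - (2 * Γ.D * j - k ⬝ᵥ Γ.x) ^ 2 / (2 * Γ.M) + (k ⬝ᵥ k) / 4 := by
  have hM0 : Γ.M ≠ 0 := by rw [hM]; exact mul_ne_zero two_ne_zero hS
  have hnx' : Γ.x ⬝ᵥ Γ.x ≠ 0 := hnx
  have hS' : Γ.tsq + Γ.x ⬝ᵥ Γ.x ≠ 0 := hS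
  rw [Γ.eq30_regroup hM0, Γ.u2_cOf d k j hnx hS hM hy, Γ.W_cOf d k j hnx hy, Γ.eq33_line2',
    dot_add_smul_self', Phi0, L]
  have hMS : Γ.M = 2 * (Γ.tsq + Γ.x ⬝ᵥ Γ.x) := hM
  simp only [nx, S] at *
  rw [hMS]
  field_simp
  ring

/-- Claim 3.12 as printed: `e^{2πiφ₇(d,k,j)} = e^{2πiΦ₀(d)} · e^{−2πi(2Dj−⟨k,x⟩)²/(2M)} · e^{2πi‖k‖²/4}`, the first
factor independent of `(k,j)` ("∝"). [cite: ChenQuantumLattice2024, Claim 3.12 p. 30–31; eq. (34) p. 31] -/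
theorem claim312_cexp (hnx : Γ.nx ≠ 0) (hS : Γ.S ≠ 0) (hM : Γ.M = 2 * Γ.S) (hy : Γ.y' = Γ.v + Γ.y) :
    Complex.exp (2 * Real.pi * Complex.I * (Γ.phi6 (Γ.cOf d k j) k j : ℝ))
      = Complex.exp (2 * Real.pi * Complex.I * (Γ.Phi0 d : ℝ))
        * Complex.exp (2 * Real.pi * Complex.I * ((-((2 * Γ.D * j - k ⬝ᵥ Γ.x) ^ 2) / (2 * Γ.M) : ℝ) : ℂ))
        * Complex.exp (2 * Real.pi * Complex.I * (((k ⬝ᵥ k) / 4 : ℝ) : ℂ)) := by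
  rw [Γ.claim312_exact d k j hnx hS hM hy, ← Complex.exp_add, ← Complex.exp_add]
  congr 1
  push_cast
  ring

/-- The register content `R` of eq. (32) in the shape of eq. (34)/(35): `R = (2Dj′)x + v′ + (M/2)k` with
`2Dj′ := 2Dj − ⟨k,x⟩` and `v′ := k′x − v` (p. 31). [cite: ChenQuantumLattice2024, eq. (34)–(35) p. 31] -/
theorem R_eq_eq35 (j' : ℝ) (hj' : 2 * Γ.D * j' = 2 * Γ.D * j - k ⬝ᵥ Γ.x) :
    Γ.R k j = (2 * Γ.D * j') • Γ.x + (Γ.kr • Γ.x - Γ.v) + (Γ.M / 2) • k := by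
  ext t
  simp only [R, hj', Pi.add_apply, Pi.sub_apply, Pi.smul_apply, smul_eq_mul]
  ring

end Step7

end Data

/-! ## 7. Dictionary to eq. (35) / `Shape.phi7` of `ChenQuantumLWESteps` -/

/-- `⟨k,x⟩ ∈ 2Dℤ` for `k ∈ 0|ℤⁿ⁻¹` when `x = Db` with `b_tail ∈ 2ℤ` (p. 31: "since we set `b[2..n] ∈ 2ℤ` we can
make sure that `⟨k_c,x⟩ ∈ 2Dℤ`"; `Shape.Admissible.b_tail` has `2p₁ ∣ bᵢ`), so `2Dj − ⟨k,x⟩ = 2Dj′` with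
`j′ ∈ ℤ`. [cite: ChenQuantumLattice2024, p. 31 (after Claim 3.12); eq. (12) p. 17] -/
theorem twoDj_sub_dot_mem (i₀ : ι) (D : ℝ) (b k : ι → ℤ) (hk0 : k i₀ = 0) (hb : ∀ i, i ≠ i₀ → (2 : ℤ) ∣ b i)
    (j : ℤ) :
    ∃ j' : ℤ, 2 * D * j - (fun i => (k i : ℝ)) ⬝ᵥ (fun i => D * b i) = 2 * D * j' := by
  classical
  have hdiv : (2 : ℤ) ∣ k ⬝ᵥ b := by
    unfold dotProduct
    refine Finset.dvd_sum fun i _ => ?_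
    by_cases hi : i = i₀
    · subst hi; simp [hk0]
    · exact Dvd.dvd.mul_left (hb i hi) _
  obtain ⟨m, hm⟩ := hdiv
  refine ⟨j - m, ?_⟩
  have hcast : (fun i => (k i : ℝ)) ⬝ᵥ (fun i => D * (b i : ℝ)) = D * ((k ⬝ᵥ b : ℤ) : ℝ) := by
    simp only [dotProduct, Int.cast_sum, Int.cast_mul, Finset.mul_sum]
    refine Finset.sum_congr rfl fun i _ => ?_
    ring
  rw [hcast, hm]
  push_cast
  ring

/-- The chirp of eq. (35): with `M = 2D²P′` (C.3: `M/(2D²) = p₁⋯p_κ =: P′`, an odd square-free integer),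
`(2Dj)²/(2M) = j²/P′`. [cite: ChenQuantumLattice2024, eq. (35) p. 31; Cond. C.3 p. 18] -/
theorem chirp_exponent (D M P' j : ℝ) (hD : D ≠ 0) (hP : P' ≠ 0) (hM : M = 2 * D ^ 2 * P') :
    -((2 * D * j) ^ 2) / (2 * M) = -(j ^ 2) / P' := by
  rw [hM]
  field_simp

/-- Docking onto `Shape.phi7`: for every `Shape`, `Shape.M = 2·D²·Shape.P`, so the eq. (35) phase
`e(−(2Dj)²/(2M))` IS the `e(−j²/P)` of `Shape.phi7`. [cite: ChenQuantumLattice2024, eq. (35) p. 31; Cond. C.3 p. 18] -/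
theorem e_chirp_eq_phi7_phase (S : Shape) (j : ℤ) :
    e (-(((2 * (S.D : ℚ) * j) ^ 2)) / (2 * (S.M : ℚ))) = e (-((j : ℚ) ^ 2) / (S.P : ℚ)) := by
  have hM : ((S.M : ℕ) : ℚ) = 2 * ((S.D : ℕ) : ℚ) ^ 2 * ((S.P : ℕ) : ℚ) := by
    simp only [Shape.M, Shape.N, PNat.mul_coe, Nat.cast_mul, Nat.cast_ofNat, PNat.val_ofNat]
    ring
  have hD : ((S.D : ℕ) : ℚ) ≠ 0 := by exact_mod_cast S.D.ne_zero
  have hP : ((S.P : ℕ) : ℚ) ≠ 0 := by exact_mod_cast S.P.ne_zero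
  congr 1
  rw [hM]
  field_simp

/-- C.1–C.3 bookkeeping behind `M = 2(t²+‖x‖²) = 2D²P′` and `t²/D² ∈ ℤ`: if `t² = c·‖x‖²` (C.1 with the correct
guess `u² = ‖x‖²`), `‖x‖² = D²‖b‖²` (`x = Db`) and `(c+1)‖b‖² = P′` (C.3), then `2(t² + ‖x‖²) = 2D²P′` and
`t²/D² = c‖b‖²`. [cite: ChenQuantumLattice2024, Cond. C.1–C.3 p. 18] -/
theorem conditions_bookkeeping (tsq nx D nb c P' : ℝ) (hD : D ≠ 0) (h1 : tsq = c * nx) (h2 : nx = D ^ 2 * nb)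
    (h3 : (c + 1) * nb = P') : 2 * (tsq + nx) = 2 * D ^ 2 * P' ∧ tsq / D ^ 2 = c * nb := by
  subst h1 h2
  rw [← h3]
  constructor
  · ring
  · field_simp

end

end Steps3to7

end Literature.Computability.Cryptography.Chen2024
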